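import Literature.Topology.FourManifolds.TautFoliations
import Literature.Topology.PlaneTopology.ChartParity
import HarnessLib

/-!
# Tangential comparison of flow boxes and the chart-change formula for the parity

Topic: Topology / PlanarFoliations (transversely oriented `C⁰` foliations of planar domains
with one-dimensional leaves, towards a Poincaré–Bendixson theory). For a foliation
`F : Foliation ℝ X` (`Literature/Topology/FourManifolds/TautFoliations.lean`: flow boxes
`X ⊇ U ≃ ℝ × ℝ`, leaf coordinate × height) two boxes `e, e'` around a point `x` are compared
**tangentially**: along the common plaques near `x` their leaf coordinates increase together
(`TangentSame e e' x`) or oppositely (`TangentOpp e e' x`), and one of the two always holds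
(`tangentSame_or_tangentOpp`: a continuous injective real function on an interval is monotone,
and the direction is locally constant in the height).

When `X` is openly embedded in the plane by `ι`, the parities of the two boxes
(`Literature/Topology/PlaneTopology/ChartParity.lean`: the winding number of the image of a
small chart circle) are then related by the **chart-change formula**
(`parity_eq_of_tangentSame`, `parity_eq_neg_of_tangentOpp`): equal for tangentially agreeing
boxes, opposite otherwise, for a transversely oriented foliation. Proof: in the coordinates of
`e'` the change of box `h = e ∘ e'.symm` has the form `(g(u, t), γ(t))` with `γ` increasing and
`g(·, t)` increasing (or decreasing); the straight-line homotopy from `h` to the affine map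
`(u, t) ↦ (±u, t)` (recentred) stays injective, so the image circles avoid the image of the
centre throughout and the winding number is constant (`wind_eq_of_homotopy`); at the end the
loop is the chart circle of `e`, traversed backwards in the decreasing case
(`wind_comp_const_sub`: reversing a loop negates its winding number).

All statements are [folklore].
-/

noncomputable section

open Set Filter Metric Function Complex
open _root_.Topology
open scoped Real
open Literature.Topology.FourManifolds Literature.Topology.PlaneTopology

namespace Literature.Topology.PlanarFoliations

/-! ## Winding numbers of shifted and reversed loops -/

/-- **Shifting the parameter of a periodic loop does not change its winding number** (homotopy
through the shifts). [folklore] -/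
theorem wind_comp_add_const {f : ℝ → ℂ} (hf : Continuous f) (hp : Function.Periodic f 1)
    (hne : ∀ t, f t ≠ 0) (a : ℝ) : wind (fun t ↦ f (t + a)) = wind f := by
  have h := wind_eq_of_homotopy (H := fun s t ↦ f (t + s * a)) (by fun_prop)
    (fun s _ ↦ by simpa [add_comm] using (hp (0 + s * a)).symm) (fun s _ t _ ↦ hne _)
  simp only [zero_mul, add_zero, one_mul] at h
  exact h.symm

/-- **Reversing a loop negates its winding number.** [folklore] -/
theorem wind_comp_one_sub {f : ℝ → ℂ} (hf : IsNonvanishingLoop f) : wind (fun t ↦ f (1 - t)) = -wind f := by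
  obtain ⟨l, hl, hle⟩ := hf.hasLogOn
  have h₁ := wind_spec hl hle hf.eq_endpoints
  have hl' : ContinuousOn (fun t ↦ l (1 - t)) (Icc 0 1) :=
    hl.comp (continuousOn_const.sub continuousOn_id) fun t ht ↦ ⟨by linarith [ht.2], by linarith [ht.1]⟩
  have hle' : ∀ t ∈ Icc (0 : ℝ) 1, exp (l (1 - t)) = f (1 - t) := fun t ht ↦
    hle _ ⟨by linarith [ht.2], by linarith [ht.1]⟩
  have h₂ := wind_spec (f := fun t ↦ f (1 - t)) hl' hle' (by simp [hf.eq_endpoints])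
  simp only [sub_self, sub_zero] at h₂
  have h₃ : (wind fun t ↦ f (1 - t)) * (2 * π * I) = (-wind f : ℤ) * (2 * π * I) := by
    rw [← h₂, Int.cast_neg, neg_mul, ← h₁]; ring
  exact int_eq_of_mul_two_pi_I_eq h₃

/-- Reversing and shifting a periodic loop negates its winding number:
`wind (f (a - ·)) = - wind f`. [folklore] -/
theorem wind_comp_const_sub {f : ℝ → ℂ} (hf : Continuous f) (hp : Function.Periodic f 1)
    (hne : ∀ t, f t ≠ 0) (a : ℝ) : wind (fun t ↦ f (a - t)) = -wind f := by
  have h1 : (fun t ↦ f (a - t)) = fun t ↦ (fun s ↦ f (1 - s)) (t + (1 - a)) := by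
    funext t; simp only; congr 1; ring
  rw [h1, wind_comp_add_const (f := fun s ↦ f (1 - s)) (by fun_prop) (fun s ↦ by
    simp only; rw [show 1 - (s + 1) = (1 - s) - 1 by ring]; exact hp.sub_eq (1 - s)) (fun t ↦ hne _)]
  exact wind_comp_one_sub ⟨hf.continuousOn, fun t _ ↦ hne t, by simpa using (hp 0).symm⟩

/-! ## Tangential comparison of two flow boxes -/

section Tangent

variable {X : Type*} [TopologicalSpace X] (F : Foliation ℝ X)
variable {e e' : OpenPartialHomeomorph X (ℝ × ℝ)} {x : X}

/-- `e'` **agrees tangentially** with `e` near `x`: on some neighbourhood, along the plaques of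
`e` the leaf coordinates of `e` and of `e'` increase together. [folklore] -/
def TangentSame (e e' : OpenPartialHomeomorph X (ℝ × ℝ)) (x : X) : Prop :=
  ∃ U ∈ 𝓝 x, ∀ y ∈ U ∩ (e.source ∩ e'.source), ∀ z ∈ U ∩ (e.source ∩ e'.source),
    (e y).2 = (e z).2 → (e y).1 < (e z).1 → (e' y).1 < (e' z).1

/-- `e'` **disagrees tangentially** with `e` near `x`: along the plaques of `e` the leaf
coordinate of `e'` decreases when that of `e` increases. [folklore] -/
def TangentOpp (e e' : OpenPartialHomeomorph X (ℝ × ℝ)) (x : X) : Prop :=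
  ∃ U ∈ 𝓝 x, ∀ y ∈ U ∩ (e.source ∩ e'.source), ∀ z ∈ U ∩ (e.source ∩ e'.source),
    (e y).2 = (e z).2 → (e y).1 < (e z).1 → (e' z).1 < (e' y).1

variable {F}

/-- **Two flow boxes are tangentially comparable**: near a common point, `e'` agrees or
disagrees tangentially with `e`. In the coordinates of `e`, for each height `t` the leaf
coordinate of `e'` is a continuous injective function of the leaf coordinate of `e` on an
interval (injective because equal heights in `e` give equal heights in `e'` near `x`, and
`e'` is injective), hence strictly monotone; its direction at the height of `x` persists at
nearby heights by continuity. [folklore] -/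
theorem tangentSame_or_tangentOpp (he : e ∈ F.atlas) (he' : e' ∈ F.atlas) (hx : x ∈ e.source)
    (hx' : x ∈ e'.source) : TangentSame e e' x ∨ TangentOpp e e' x := by
  -- a neighbourhood where equal `e`-heights give equal `e'`-heights
  obtain ⟨U₀, hU₀, hpl⟩ := F.locally_plaque e he e' he' x ⟨hx, hx'⟩
  obtain ⟨O, hOU, hOo, hxO⟩ := mem_nhds_iff.1 (inter_mem hU₀ (inter_mem (e.open_source.mem_nhds hx)
    (e'.open_source.mem_nhds hx')))
  -- a closed box in the coordinates of `e` whose preimage lies in `O`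
  have hsymm : Continuous e.symm := by
    have := e.continuousOn_symm; rw [F.target_eq e he, continuousOn_univ] at this; exact this
  have hOpre : e.symm ⁻¹' O ∈ 𝓝 (e x) := (hOo.preimage hsymm).mem_nhds (by
    show e.symm (e x) ∈ O; rw [e.left_inv hx]; exact hxO)
  obtain ⟨η, hη, hball⟩ := Metric.mem_nhds_iff.1 hOpre
  set p := e x with hp
  -- `g (u, t)` : the leaf coordinate of `e'` in the coordinates of `e`
  set g : ℝ → ℝ → ℝ := fun u t ↦ (e' (e.symm (u, t))).1 with hg
  have hmemO : ∀ u t, |u - p.1| < η → |t - p.2| < η → e.symm (u, t) ∈ O := fun u t hu ht ↦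
    hball (by rw [mem_ball, Prod.dist_eq, Real.dist_eq, Real.dist_eq]; exact max_lt hu ht)
  have hO₁ : ∀ w ∈ O, w ∈ U₀ ∩ (e.source ∩ e'.source) := fun w hw ↦ hOU hw
  -- continuity and injectivity of `g (·, t)` on `[p.1 - η/2, p.1 + η/2]` for `|t - p.2| < η`
  have hcont : ∀ t, |t - p.2| < η → ContinuousOn (fun u ↦ g u t) (Icc (p.1 - η / 2) (p.1 + η / 2)) := by
    intro t ht u hu
    have hu' : |u - p.1| < η := by rw [abs_lt]; constructor <;> linarith [hu.1, hu.2]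
    have hsrc : e.symm (u, t) ∈ e'.source := (hO₁ _ (hmemO u t hu' ht)).2.2
    have h1 : Continuous (fun u : ℝ ↦ e.symm (u, t)) := hsymm.comp (continuous_id.prodMk continuous_const)
    have h2 : ContinuousAt (fun u : ℝ ↦ e' (e.symm (u, t))) u := (e'.continuousAt hsrc).comp_of_eq h1.continuousAt rfl
    exact (continuous_fst.continuousAt.comp h2).continuousWithinAt
  have hinj : ∀ t, |t - p.2| < η → InjOn (fun u ↦ g u t) (Icc (p.1 - η / 2) (p.1 + η / 2)) := by
    intro t ht u hu u' hu' huu'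
    have hu₁ : |u - p.1| < η := by rw [abs_lt]; constructor <;> linarith [hu.1, hu.2]
    have hu₁' : |u' - p.1| < η := by rw [abs_lt]; constructor <;> linarith [hu'.1, hu'.2]
    have hy := hO₁ _ (hmemO u t hu₁ ht)
    have hz := hO₁ _ (hmemO u' t hu₁' ht)
    have htgt : ∀ q : ℝ × ℝ, q ∈ e.target := fun q ↦ by rw [F.target_eq e he]; exact mem_univ _
    have h2 : (e' (e.symm (u, t))).2 = (e' (e.symm (u', t))).2 :=
      hpl _ hy _ hz (by rw [e.right_inv (htgt _), e.right_inv (htgt _)])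
    have h3 : e' (e.symm (u, t)) = e' (e.symm (u', t)) := Prod.ext huu' h2
    have h4 : e.symm (u, t) = e.symm (u', t) := e'.injOn hy.2.2 hz.2.2 h3
    have h5 : ((u, t) : ℝ × ℝ) = (u', t) := e.symm.injOn (htgt _) (htgt _) h4
    exact congrArg Prod.fst h5
  have hmono : ∀ t, |t - p.2| < η → StrictMonoOn (fun u ↦ g u t) (Icc (p.1 - η / 2) (p.1 + η / 2)) ∨
      StrictAntiOn (fun u ↦ g u t) (Icc (p.1 - η / 2) (p.1 + η / 2)) := fun t ht ↦
    (hcont t ht).strictMonoOn_of_injOn_Icc' (by linarith) (hinj t ht)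
  -- the direction at height `p.2` persists nearby
  set d : ℝ → ℝ := fun t ↦ g (p.1 + η / 2) t - g (p.1 - η / 2) t with hd
  have hd0 : d p.2 ≠ 0 := by
    intro h0
    have := hinj p.2 (by simpa using hη) ⟨by linarith, le_rfl⟩ ⟨le_rfl, by linarith⟩ (sub_eq_zero.1 h0)
    linarith
  have hdc : ContinuousAt d p.2 := by
    have hca : ∀ u, |u - p.1| < η → ContinuousAt (fun t ↦ g u t) p.2 := fun u hu ↦ by
      have hsrc : e.symm (u, p.2) ∈ e'.source := (hO₁ _ (hmemO u p.2 hu (by simpa using hη))).2.2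
      have h1 : Continuous (fun t : ℝ ↦ e.symm (u, t)) := hsymm.comp (continuous_const.prodMk continuous_id)
      have h2 : ContinuousAt (fun t : ℝ ↦ e' (e.symm (u, t))) p.2 :=
        (e'.continuousAt hsrc).comp_of_eq h1.continuousAt rfl
      exact continuous_fst.continuousAt.comp h2
    exact (hca _ (by rw [show p.1 + η / 2 - p.1 = η / 2 by ring, abs_of_pos (by positivity)]; linarith)).sub
      (hca _ (by rw [show p.1 - η / 2 - p.1 = -(η / 2) by ring, abs_neg, abs_of_pos (by positivity)]; linarith))
  obtain ⟨η', hη', hsign⟩ : ∃ η' > (0 : ℝ), ∀ t, |t - p.2| < η' → |d t - d p.2| < |d p.2| := by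
    have := Metric.tendsto_nhds_nhds.1 hdc.tendsto |d p.2| (abs_pos.2 hd0)
    obtain ⟨δ, hδ, h⟩ := this
    exact ⟨δ, hδ, fun t ht ↦ by have := h (by rwa [Real.dist_eq]); rwa [Real.dist_eq] at this⟩
  -- the neighbourhood on which the comparison holds
  set ε : ℝ := min (η / 2) η' with hε
  have hε₀ : 0 < ε := lt_min (by positivity) hη'
  set U : Set X := {y | y ∈ e.source ∧ e y ∈ ball p ε} with hU
  have hUo : U ∈ 𝓝 x := by
    have : U = e.source ∩ e ⁻¹' ball p ε := rfl
    rw [this]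
    exact (e.continuousOn.isOpen_inter_preimage e.open_source isOpen_ball).mem_nhds ⟨hx, mem_ball_self hε₀⟩
  -- reading a point of `U` in the box
  have hread : ∀ y ∈ U, (e y).1 ∈ Icc (p.1 - η / 2) (p.1 + η / 2) ∧ |(e y).2 - p.2| < η ∧
      |(e y).2 - p.2| < η' ∧ g (e y).1 (e y).2 = (e' y).1 := by
    intro y hy
    have hb := hy.2
    rw [mem_ball, Prod.dist_eq, Real.dist_eq, Real.dist_eq, max_lt_iff] at hb
    have h1 : |(e y).1 - p.1| < η / 2 := lt_of_lt_of_le hb.1 (min_le_left _ _)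
    have h2 : |(e y).2 - p.2| < η' := lt_of_lt_of_le hb.2 (min_le_right _ _)
    have h3 : |(e y).2 - p.2| < η := lt_of_lt_of_le hb.2 ((min_le_left _ _).trans (by linarith))
    rw [abs_lt] at h1
    refine ⟨⟨by linarith [h1.1], by linarith [h1.2]⟩, h3, h2, ?_⟩
    show (e' (e.symm ((e y).1, (e y).2))).1 = (e' y).1
    rw [Prod.mk.eta, e.left_inv hy.1]
  rcases lt_or_gt_of_ne hd0 with hneg | hpos
  · -- decreasing at `p.2`, hence nearby: tangential disagreement
    right
    refine ⟨U, hUo, fun y hy z hz hyz hlt ↦ ?_⟩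
    obtain ⟨hyI, hyη, hyη', hgy⟩ := hread y hy.1
    obtain ⟨hzI, -, -, hgz⟩ := hread z hz.1
    rw [← hgy, ← hgz, ← hyz]
    have hdt : d (e y).2 < 0 := by
      have := hsign _ hyη'
      rw [abs_lt, abs_of_neg hneg] at this
      linarith [this.2]
    rcases hmono _ hyη with hm | hm
    · exfalso
      have : g (p.1 - η / 2) (e y).2 < g (p.1 + η / 2) (e y).2 :=
        hm ⟨le_rfl, by linarith⟩ ⟨by linarith, le_rfl⟩ (by linarith)
      simp only [hd] at hdt
      linarith
    · exact hm hyI hzI hlt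
  · -- increasing at `p.2`, hence nearby: tangential agreement
    left
    refine ⟨U, hUo, fun y hy z hz hyz hlt ↦ ?_⟩
    obtain ⟨hyI, hyη, hyη', hgy⟩ := hread y hy.1
    obtain ⟨hzI, -, -, hgz⟩ := hread z hz.1
    rw [← hgy, ← hgz, ← hyz]
    have hdt : 0 < d (e y).2 := by
      have := hsign _ hyη'
      rw [abs_lt, abs_of_pos hpos] at this
      linarith [this.1]
    rcases hmono _ hyη with hm | hm
    · exact hm hyI hzI hlt
    · exfalso
      have : g (p.1 + η / 2) (e y).2 < g (p.1 - η / 2) (e y).2 :=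
        hm ⟨le_rfl, by linarith⟩ ⟨by linarith, le_rfl⟩ (by linarith)
      simp only [hd] at hdt
      linarith

end Tangent

/-! ## The chart-change formula for the parity -/

section ChartChange

variable {X : Type*} [TopologicalSpace X] {F : Foliation ℝ X} {ι : X → ℂ}
variable {e e' : OpenPartialHomeomorph X (ℝ × ℝ)} {x : X}

/-- **The chart-change homotopy.** Core of the chart-change formula: in the coordinates of
`e'`, the straight-line homotopy from `e ∘ e'.symm` to the recentred affine map
`(u, t) ↦ (σ u, t)` (`σ = ±1` the tangential sign) is injective on a ball about `e' x` at
every time, so the winding numbers of the images of a small circle are all equal: the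
parity of `e'` at `x` equals the winding number of the `e`-image of the circle `(σ cos, sin)`.
[folklore] -/
theorem parity_eq_wind_of_sign (hι : IsOpenEmbedding ι) (he : e ∈ F.atlas) (he' : e' ∈ F.atlas)
    (hx : x ∈ e.source) (hx' : x ∈ e'.source) {σ : ℝ} (hσ : σ = 1 ∨ σ = -1) {W : Set X} (hW : W ∈ 𝓝 x)
    (hpl : ∀ y ∈ W, ∀ z ∈ W, (e' y).2 = (e' z).2 → (e y).2 = (e z).2)
    (htr : ∀ y ∈ W, ∀ z ∈ W, (e' y).2 < (e' z).2 → (e y).2 < (e z).2)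
    (htan : ∀ y ∈ W, ∀ z ∈ W, (e' y).2 = (e' z).2 → (e' y).1 < (e' z).1 → σ * (e y).1 < σ * (e z).1) :
    ∃ ρ > (0 : ℝ), parity ι e' x =
      wind fun θ ↦ ι (e.symm ((e x).1 + σ * (ρ * Real.cos (2 * π * θ)), (e x).2 + ρ * Real.sin (2 * π * θ))) - ι x := by
  have hιc := hι.continuous
  have hιi := hι.injective
  have htgt : ∀ q : ℝ × ℝ, q ∈ e.target := fun q ↦ by rw [F.target_eq e he]; exact mem_univ _
  have htgt' : ∀ q : ℝ × ℝ, q ∈ e'.target := fun q ↦ by rw [F.target_eq e' he']; exact mem_univ _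
  have hsymm' : Continuous e'.symm := by
    have := e'.continuousOn_symm; rw [F.target_eq e' he', continuousOn_univ] at this; exact this
  have hsymm : Continuous e.symm := by
    have := e.continuousOn_symm; rw [F.target_eq e he, continuousOn_univ] at this; exact this
  -- shrink `W` into the sources and pull it back to a ball about `p' = e' x`
  obtain ⟨O, hOW, hOo, hxO⟩ := mem_nhds_iff.1 (inter_mem hW (inter_mem (e.open_source.mem_nhds hx)
    (e'.open_source.mem_nhds hx')))
  set p := e x with hp
  set p' := e' x with hp'
  have hOpre : e'.symm ⁻¹' O ∈ 𝓝 p' := (hOo.preimage hsymm').mem_nhds (by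
    show e'.symm (e' x) ∈ O; rw [e'.left_inv hx']; exact hxO)
  obtain ⟨η, hη, hball⟩ := Metric.mem_nhds_iff.1 hOpre
  have hmem : ∀ q ∈ ball p' η, e'.symm q ∈ W ∧ e'.symm q ∈ e.source ∧ e'.symm q ∈ e'.source :=
    fun q hq ↦ hOW (hball hq)
  -- the homotopy
  set A : ℝ × ℝ → ℝ × ℝ := fun q ↦ (σ * (q.1 - p'.1) + p.1, (q.2 - p'.2) + p.2) with hA
  set H : ℝ → ℝ × ℝ → ℝ × ℝ := fun s q ↦ (1 - s) • e (e'.symm q) + s • A q with hH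
  have hHp' : ∀ s, H s p' = p := fun s ↦ by
    have h1 : e (e'.symm p') = p := by rw [hp', e'.left_inv hx']
    have h2 : A p' = p := by
      show (σ * (p'.1 - p'.1) + p.1, (p'.2 - p'.2) + p.2) = p
      simp only [sub_self, mul_zero, zero_add, Prod.mk.eta]
    show (1 - s) • e (e'.symm p') + s • A p' = p
    rw [h1, h2, ← add_smul, sub_add_cancel, one_smul]
  have hσ2 : σ * σ = 1 := by rcases hσ with rfl | rfl <;> norm_num
  -- injectivity of `H s` on the ball, for `s ∈ [0, 1]`
  have hHinj : ∀ s ∈ Icc (0 : ℝ) 1, InjOn (H s) (ball p' η) := by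
    intro s hs q hq q' hq' hqq
    obtain ⟨hyW, hyS, hyS'⟩ := hmem q hq
    obtain ⟨hzW, hzS, hzS'⟩ := hmem q' hq'
    have hq2 : (e' (e'.symm q)).2 = q.2 := by rw [e'.right_inv (htgt' q)]
    have hq2' : (e' (e'.symm q')).2 = q'.2 := by rw [e'.right_inv (htgt' q')]
    have hq1 : (e' (e'.symm q)).1 = q.1 := by rw [e'.right_inv (htgt' q)]
    have hq1' : (e' (e'.symm q')).1 = q'.1 := by rw [e'.right_inv (htgt' q')]
    have h2 : ((1 - s) * (e (e'.symm q)).2 + s * ((q.2 - p'.2) + p.2)) =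
        ((1 - s) * (e (e'.symm q')).2 + s * ((q'.2 - p'.2) + p.2)) := by
      have := congrArg Prod.snd hqq
      simpa [hH, hA] using this
    have h1 : ((1 - s) * (e (e'.symm q)).1 + s * (σ * (q.1 - p'.1) + p.1)) =
        ((1 - s) * (e (e'.symm q')).1 + s * (σ * (q'.1 - p'.1) + p.1)) := by
      have := congrArg Prod.fst hqq
      simpa [hH, hA] using this
    -- the second coordinates agree
    have ht : q.2 = q'.2 := by
      by_contra hne
      rcases lt_or_gt_of_ne hne with hlt | hlt
      · have := htr _ hyW _ hzW (by rw [hq2, hq2']; exact hlt)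
        rcases hs.2.eq_or_lt with h | h
        · rw [h] at h2; simp at h2; linarith
        · have : (1 - s) * (e (e'.symm q)).2 < (1 - s) * (e (e'.symm q')).2 := by nlinarith
          nlinarith [hs.1]
      · have := htr _ hzW _ hyW (by rw [hq2, hq2']; exact hlt)
        rcases hs.2.eq_or_lt with h | h
        · rw [h] at h2; simp at h2; linarith
        · have : (1 - s) * (e (e'.symm q')).2 < (1 - s) * (e (e'.symm q)).2 := by nlinarith
          nlinarith [hs.1]
    -- hence the heights in `e` agree, and the first coordinates agree
    have het : (e (e'.symm q)).2 = (e (e'.symm q')).2 := hpl _ hyW _ hzW (by rw [hq2, hq2', ht])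
    have hu : q.1 = q'.1 := by
      by_contra hne
      -- multiply the first-coordinate identity by `σ`
      have h1σ : (1 - s) * (σ * (e (e'.symm q)).1) + s * ((q.1 - p'.1) + σ * p.1) =
          (1 - s) * (σ * (e (e'.symm q')).1) + s * ((q'.1 - p'.1) + σ * p.1) := by
        linear_combination σ * h1 - (s * (q.1 - p'.1) - s * (q'.1 - p'.1)) * hσ2
      rcases lt_or_gt_of_ne hne with hlt | hlt
      · have := htan _ hyW _ hzW (by rw [hq2, hq2', ht]) (by rw [hq1, hq1']; exact hlt)
        rcases hs.2.eq_or_lt with h | h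
        · rw [h] at h1σ; simp at h1σ; linarith
        · have : (1 - s) * (σ * (e (e'.symm q)).1) < (1 - s) * (σ * (e (e'.symm q')).1) := by nlinarith
          nlinarith [hs.1]
      · have := htan _ hzW _ hyW (by rw [hq2, hq2', ht]) (by rw [hq1, hq1']; exact hlt)
        rcases hs.2.eq_or_lt with h | h
        · rw [h] at h1σ; simp at h1σ; linarith
        · have : (1 - s) * (σ * (e (e'.symm q')).1) < (1 - s) * (σ * (e (e'.symm q)).1) := by nlinarith
          nlinarith [hs.1]
    exact Prod.ext hu ht
  -- the circle of radius `ρ = η / 2` about `p'` stays in the ball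
  set ρ : ℝ := η / 2 with hρ
  have hρ₀ : 0 < ρ := by positivity
  set circ : ℝ → ℝ × ℝ := fun θ ↦ (p'.1 + ρ * Real.cos (2 * π * θ), p'.2 + ρ * Real.sin (2 * π * θ)) with hcirc
  have hcirc_mem : ∀ θ, circ θ ∈ ball p' η := fun θ ↦ by
    rw [mem_ball, Prod.dist_eq, Real.dist_eq, Real.dist_eq, max_lt_iff]
    constructor
    · rw [show p'.1 + ρ * Real.cos (2 * π * θ) - p'.1 = ρ * Real.cos (2 * π * θ) by ring, abs_mul,
        abs_of_pos hρ₀]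
      nlinarith [Real.abs_cos_le_one (2 * π * θ), abs_nonneg (Real.cos (2 * π * θ))]
    · rw [show p'.2 + ρ * Real.sin (2 * π * θ) - p'.2 = ρ * Real.sin (2 * π * θ) by ring, abs_mul,
        abs_of_pos hρ₀]
      nlinarith [Real.abs_sin_le_one (2 * π * θ), abs_nonneg (Real.sin (2 * π * θ))]
  have hcirc_ne : ∀ θ, circ θ ≠ p' := fun θ h ↦ by
    have h1 := congrArg Prod.fst h
    have h2 := congrArg Prod.snd h
    simp only [hcirc, add_eq_left, mul_eq_zero, hρ₀.ne', false_or] at h1 h2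
    have := Real.sin_sq_add_cos_sq (2 * π * θ)
    rw [h1, h2] at this
    norm_num at this
  have hcirc_cont : Continuous circ := by
    simp only [hcirc]
    fun_prop
  have hcirc_per : ∀ θ, circ (θ + 1) = circ θ := fun θ ↦ by
    simp only [hcirc, mul_add, mul_one]
    rw [Real.cos_add_two_pi, Real.sin_add_two_pi]
  -- the homotopy of loops and its winding numbers
  set L : ℝ → ℝ → ℂ := fun s θ ↦ ι (e.symm (H s (circ θ))) - ι x with hL
  have hLne : ∀ s ∈ Icc (0 : ℝ) 1, ∀ θ, L s θ ≠ 0 := by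
    intro s hs θ h0
    have h1 : ι (e.symm (H s (circ θ))) = ι (e.symm p) := by
      rw [hp, e.left_inv hx]; exact sub_eq_zero.1 h0
    have h2 : H s (circ θ) = p := e.symm.injOn (htgt _) (htgt _) (hιi h1)
    rw [← hHp' s] at h2
    exact hcirc_ne θ (hHinj s hs (hcirc_mem θ) (mem_ball_self hη) h2)
  have hLcont : ContinuousOn (uncurry L) (Icc 0 1 ×ˢ Icc 0 1) := by
    have hE : ContinuousOn (fun q : ℝ × ℝ ↦ e (e'.symm q)) (ball p' η) :=
      e.continuousOn.comp hsymm'.continuousOn fun q hq ↦ (hmem q hq).2.1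
    have hHc : ContinuousOn (fun sq : ℝ × (ℝ × ℝ) ↦ H sq.1 sq.2) (univ ×ˢ ball p' η) := by
      simp only [hH, hA]
      refine ContinuousOn.add ?_ ?_
      · exact ((continuous_const.sub continuous_fst).continuousOn).smul
          (hE.comp continuousOn_snd fun sq hsq ↦ hsq.2)
      · exact (continuous_fst.smul (by fun_prop)).continuousOn
    have hmap : ContinuousOn (fun st : ℝ × ℝ ↦ (st.1, circ st.2)) (Icc 0 1 ×ˢ Icc 0 1) := by fun_prop
    have h1 : ContinuousOn (fun st : ℝ × ℝ ↦ H st.1 (circ st.2)) (Icc 0 1 ×ˢ Icc 0 1) :=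
      hHc.comp hmap fun st _ ↦ ⟨mem_univ _, hcirc_mem _⟩
    exact ((hιc.comp hsymm).comp_continuousOn h1).sub continuousOn_const
  have hLloop : ∀ s ∈ Icc (0 : ℝ) 1, L s 0 = L s 1 := fun s _ ↦ by
    simp only [hL]
    rw [show (1 : ℝ) = 0 + 1 from (zero_add 1).symm, hcirc_per]
  have hwind := wind_eq_of_homotopy hLcont hLloop fun s hs θ _ ↦ hLne s hs θ
  -- time `0`: the chart loop of `e'`
  have hL0 : L 0 = fun θ ↦ chartLoop ι e' x ρ θ - ι x := by
    funext θ
    have h1 : H 0 (circ θ) = e (e'.symm (circ θ)) := by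
      simp only [hH, sub_zero, one_smul, zero_smul, add_zero]
    show ι (e.symm (H 0 (circ θ))) - ι x = chartLoop ι e' x ρ θ - ι x
    rw [h1, e.left_inv (hmem _ (hcirc_mem θ)).2.1, chartLoop_eq]
  -- time `1`: the affine image
  have hL1 : L 1 = fun θ ↦ ι (e.symm ((e x).1 + σ * (ρ * Real.cos (2 * π * θ)),
      (e x).2 + ρ * Real.sin (2 * π * θ))) - ι x := by
    funext θ
    simp only [hL, hH, hA, hcirc, sub_self, zero_smul, one_smul, zero_add, ← hp]
    congr 3
    ring
  refine ⟨ρ, hρ₀, ?_⟩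
  rw [← wind_chartLoop_sub hιc hιi (F.target_eq e' he') hx' hρ₀, ← hL0, hwind, hL1]

/-- **Chart-change formula, agreeing case**: for a transversely oriented foliation of a space
openly embedded in the plane, two flow boxes that agree tangentially near `x` have the same
parity at `x`. [folklore] -/
theorem parity_eq_of_tangentSame (hι : IsOpenEmbedding ι) (ho : F.IsTransverselyOriented) (he : e ∈ F.atlas)
    (he' : e' ∈ F.atlas) (hx : x ∈ e.source) (hx' : x ∈ e'.source) (hs : TangentSame e' e x) :
    parity ι e' x = parity ι e x := by
  obtain ⟨U₁, hU₁, hpl⟩ := F.locally_plaque e' he' e he x ⟨hx', hx⟩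
  obtain ⟨U₂, hU₂, htr⟩ := ho e' he' e he x ⟨hx', hx⟩
  obtain ⟨U₃, hU₃, htan⟩ := hs
  set W : Set X := (U₁ ∩ U₂ ∩ U₃) ∩ (e'.source ∩ e.source) with hW
  have hWn : W ∈ 𝓝 x := inter_mem (inter_mem (inter_mem hU₁ hU₂) hU₃)
    (inter_mem (e'.open_source.mem_nhds hx') (e.open_source.mem_nhds hx))
  obtain ⟨ρ, hρ, h⟩ := parity_eq_wind_of_sign (σ := 1) hι he he' hx hx' (Or.inl rfl) hWn
    (fun y hy z hz ↦ hpl y ⟨hy.1.1.1, hy.2⟩ z ⟨hz.1.1.1, hz.2⟩)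
    (fun y hy z hz ↦ htr y ⟨hy.1.1.2, hy.2⟩ z ⟨hz.1.1.2, hz.2⟩)
    (fun y hy z hz h₁ h₂ ↦ by simpa using htan y ⟨hy.1.2, hy.2⟩ z ⟨hz.1.2, hz.2⟩ h₁ h₂)
  rw [h, ← wind_chartLoop_sub hι.continuous hι.injective (F.target_eq e he) hx hρ]
  congr 1
  funext θ
  rw [chartLoop_eq, one_mul]

/-- **Chart-change formula, disagreeing case**: two flow boxes that disagree tangentially near
`x` have opposite parities at `x` (the final loop is the chart circle of `e` traversed
backwards). [folklore] -/
theorem parity_eq_neg_of_tangentOpp (hι : IsOpenEmbedding ι) (ho : F.IsTransverselyOriented) (he : e ∈ F.atlas)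
    (he' : e' ∈ F.atlas) (hx : x ∈ e.source) (hx' : x ∈ e'.source) (hs : TangentOpp e' e x) :
    parity ι e' x = -parity ι e x := by
  obtain ⟨U₁, hU₁, hpl⟩ := F.locally_plaque e' he' e he x ⟨hx', hx⟩
  obtain ⟨U₂, hU₂, htr⟩ := ho e' he' e he x ⟨hx', hx⟩
  obtain ⟨U₃, hU₃, htan⟩ := hs
  set W : Set X := (U₁ ∩ U₂ ∩ U₃) ∩ (e'.source ∩ e.source) with hW
  have hWn : W ∈ 𝓝 x := inter_mem (inter_mem (inter_mem hU₁ hU₂) hU₃)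
    (inter_mem (e'.open_source.mem_nhds hx') (e.open_source.mem_nhds hx))
  obtain ⟨ρ, hρ, h⟩ := parity_eq_wind_of_sign (σ := -1) hι he he' hx hx' (Or.inr rfl) hWn
    (fun y hy z hz ↦ hpl y ⟨hy.1.1.1, hy.2⟩ z ⟨hz.1.1.1, hz.2⟩)
    (fun y hy z hz ↦ htr y ⟨hy.1.1.2, hy.2⟩ z ⟨hz.1.1.2, hz.2⟩)
    (fun y hy z hz h₁ h₂ ↦ by simpa using htan y ⟨hy.1.2, hy.2⟩ z ⟨hz.1.2, hz.2⟩ h₁ h₂)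
  -- the final loop is `f (1/2 - θ)` for `f` the chart loop of `e` minus `ι x`
  set f : ℝ → ℂ := fun θ ↦ chartLoop ι e x ρ θ - ι x with hf
  have hfeq : (fun θ ↦ ι (e.symm ((e x).1 + -1 * (ρ * Real.cos (2 * π * θ)),
      (e x).2 + ρ * Real.sin (2 * π * θ))) - ι x) = fun θ ↦ f (1 / 2 - θ) := by
    funext θ
    show _ = chartLoop ι e x ρ (1 / 2 - θ) - ι x
    rw [chartLoop_eq, show 2 * π * (1 / 2 - θ) = π - 2 * π * θ by ring, Real.cos_pi_sub, Real.sin_pi_sub]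
    ring_nf
  have hfc : Continuous f := (continuous_chartLoop hι.continuous (F.target_eq e he) x ρ).sub continuous_const
  have hfp : Function.Periodic f 1 := fun θ ↦ by
    show chartLoop ι e x ρ (θ + 1) - ι x = chartLoop ι e x ρ θ - ι x
    rw [periodic_chartLoop x ρ θ]
  have hfne : ∀ θ, f θ ≠ 0 := fun θ ↦ sub_ne_zero.2 (chartLoop_ne hι.injective (F.target_eq e he) hx hρ.ne' θ)
  rw [h, hfeq, wind_comp_const_sub (f := f) hfc hfp hfne (1 / 2)]
  show -wind (fun θ ↦ chartLoop ι e x ρ θ - ι x) = -parity ι e x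
  rw [wind_chartLoop_sub hι.continuous hι.injective (F.target_eq e he) hx hρ]

end ChartChange

end Literature.Topology.PlanarFoliations
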